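import Summits.BirchSwinnertonDyer.BirchSwinnertonDyer.Theorems.SignedLowerHalvesKobayashiLowerHalfLargeImageBSTWTwistConsumers
import Summits.BirchSwinnertonDyer.Rank1Residual.Supersingular.KobayashiMainConjectureX7
import Literature.NumberTheory.QuadraticFields.FundamentalDiscriminant
import HarnessLib

/-!
# Route `SignedLowerHalves`, crux `KobayashiLowerHalfLargeImage` (item stmt-BirchSwinnertonDyer-19001): the BSTW-TWIST
# SUB-FAMILY of class X7 — CLASS-WIDE CONSUMERS AT MAIN-CONJECTURE LEVEL (the crux's own currency) of a twist datum
# (cell `pub/bsd-litref`, paper sub-dir `bstw24`, prover seat `bsd-litref-bstw24-pv` gen 6; companion of `…BSTWTwistConsumers.lean`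
# (p496619); a `--supports … --as helper` file; THEOREMS ONLY; closes nothing)

HONEST FRAMING (programme BSD-LIT2PART v1 §HONESTY, verbatim): «no tranche here proves BSD; ARM L moves the LITERAL column of an r ≤ 1
census into the kernel-proved-modulo-named-print column; ARM P changes what "named print" is worth.» Burungale–Skinner–Tian–Wan
arXiv:2409.01350v2 is an UNREFEREED PREPRINT; here its Thm. 1.3 twist clause enters ONLY through the tree's explicitly labelled OPEN binder
`Summit.BirchSwinnertonDyer.Rank1Residual.Supersingular.BurungaleSkinnerTianWan2024_thm13_twist_OPEN` (B4: INTRO wording, `K` a quadratic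
NUMBER FIELD, twist by `d_K`; litref D-audit of record: VERBATIM(intro), weaker than body; its printed proof road B1 is GAP(line) at Thm.
9.24's twist paragraph — sheets `pub/bsd-litref/bstw24/sheets/D-AUDIT-bstw24-r{1,2}-TWIST.md`), taken as a HYPOTHESIS — never as a theorem.
Closes nothing; class X7 stays CONSTRUCTION-SHAPED; crux 3 stays OPEN; typed ≠ proved ≠ endorsed.

WHAT. The per-pair records `…BSTWTwistRecordsNN.lean` prove for each INTRO pair the binder-free twist datum `twist_x7bstw_<label>_<p>`
(`∃ W₀ d C`, `d` a SQUARE-FREE integer, `C • W = W₀^{(d)}`, …). B4 speaks of a quadratic number field `K` and the twist by its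
DISCRIMINANT `d_K ∈ {d, 4d}`. This file bridges the two dictionaries once, class-wide:

* `exists_numberField_of_twistIntro` — from an INTRO datum: a quadratic number field `K` (`Quadratic.exists_numberField_discr_eq`, `d_K = d`
  if `d ≡ 1 (mod 4)`, else `4d`) with `d_K` coprime to `N₀·p` (every prime of `d_K` is ramified in `ℚ(√d)`, hence `≠ p` and good for
  `E₀`), every prime of `d_K` good ordinary for `E₀`, and `W` a model of `E₀^{(d_K)}` (`E₀^{(4d)} ≅ E₀^{(d)}`,
  `exists_variableChange_quadraticTwist_mul_sq`) — i.e. exactly B4's hypothesis list at the pair.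
* `kobayashiMainConjecture_of_thm13_twist_OPEN_of_twistIntro` — B4 + an INTRO datum ⇒ `KobayashiMainConjecture W p ε` for every sign.
* `exists_kobayashiLowerDivisibility_of_thm13_twist_OPEN_of_twistIntro` — the CRUX'S CONCLUSION `∃ ε, KobayashiLowerDivisibility W p ε`
  at the pair, modulo B4 (`kobayashiLowerDivisibility_of_mainConjecture`). Item 3's statement per pair; the crux untouched.

Design: THEOREMS ONLY; default heartbeats; axioms standard. References: [BurungaleSkinnerTianWan2024] Thm. 1.3 twist clause (p. 3);
[Kobayashi2003] Conjecture (p. 2), Thm. 1.2, Thm. 4.1; [SilvermanAEC2009] X.5 Cor. 5.4; Marcus, Number Fields, Ch. 2 Thm. 1 (`d_K ∈ {d, 4d}`).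
-/

set_option autoImplicit false
set_option linter.dupNamespace false

noncomputable section

open scoped Classical

open WeierstrassCurve Literature.NumberTheory.EllipticCurves
  Literature.NumberTheory.EllipticCurves.Rank1Residual
  Literature.NumberTheory.EllipticCurves.BurungaleSkinnerTianWan2024
  Literature.NumberTheory.QuadraticFields
  Summit.BirchSwinnertonDyer.Rank1Residual.Supersingular

namespace Summit.BirchSwinnertonDyer.BirchSwinnertonDyer.Theorems.X7Twist

variable (W : WeierstrassCurve ℚ) [W.IsElliptic] [W.IsGloballyMinimal] (p : ℕ) [Fact p.Prime]

/-- **A prime of the fundamental discriminant is ramified.** For a square-free `d`: a prime `ℓ` dividing `d` is ramified in `ℚ(√d)`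
(`RamifiedInQuadratic d ℓ`, first alternative), and a prime dividing `4d` is `2` or divides `d`; when `d ≢ 1 (mod 4)` the prime `2`
is ramified (second alternative). Bookkeeping. [cite: BurungaleSkinnerTianWan2024, Thm. 1.3 (twist clause; shape only)] -/
theorem ramifiedInQuadratic_of_dvd_four_mul {d : ℤ} (hd4 : d % 4 ≠ 1) {ℓ : ℕ} (hℓ : ℓ.Prime) (h : (ℓ : ℤ) ∣ 4 * d) :
    RamifiedInQuadratic d ℓ := by
  by_cases hℓ2 : ℓ = 2
  · exact Or.inr ⟨hℓ2, hd4⟩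
  · left
    have hℓZ : Prime (ℓ : ℤ) := Nat.prime_iff_prime_int.mp hℓ
    rcases hℓZ.dvd_or_dvd h with h4 | hdd
    · exfalso
      have : (ℓ : ℤ) ∣ 2 ^ 2 := by simpa using h4
      have h2 : (ℓ : ℤ) ∣ 2 := hℓZ.dvd_of_dvd_pow this
      have : ℓ ∣ 2 := by exact_mod_cast h2
      exact hℓ2 ((Nat.prime_dvd_prime_iff_eq hℓ Nat.prime_two).mp this)
    · exact hdd

omit [W.IsElliptic] [W.IsGloballyMinimal] in
/-- **From an INTRO twist datum to B4's hypothesis list at the pair.** Given the datum (`W₀` semistable, `p` good supersingular for `W₀`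
with `a_p = 0`, `d` square-free `≠ 1`, every prime ramified in `ℚ(√d)` `≠ p` and good ordinary for `W₀`, `C • W = W₀^{(d)}`):
a quadratic number field `K` with `d_K = d` (if `d ≡ 1 (mod 4)`) or `d_K = 4d` (otherwise; `Quadratic.exists_numberField_discr_eq`) such that
`d_K` is coprime to `N₀·p`, every prime of `d_K` is good ordinary for `W₀`, and `W` is a model of `W₀^{(d_K)}` (for `d_K = 4d` through
`W₀^{(4d)} ≅ W₀^{(d)}`, `exists_variableChange_quadraticTwist_mul_sq`). UNCONDITIONAL. [cite: SilvermanAEC2009, X.5 Cor. 5.4] -/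
theorem exists_numberField_of_twistIntro
    (htw : ∃ (W₀ : WeierstrassCurve ℚ) (_ : W₀.IsElliptic) (_ : W₀.IsGloballyMinimal) (d : ℤ) (C : VariableChange ℚ),
      Semistable W₀ ∧ GoodSS W₀ p ∧ W₀.frobeniusTrace p = 0 ∧ Squarefree d ∧ d ≠ 1 ∧
      (∀ (q : ℕ) [Fact q.Prime], RamifiedInQuadratic d q → q ≠ p ∧ GoodOrd W₀ q) ∧
      C • W = W₀.quadraticTwist (d : ℚ)) :
    ∃ (W₀ : WeierstrassCurve ℚ) (_ : W₀.IsElliptic) (_ : W₀.IsGloballyMinimal)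
      (K : Type) (_ : Field K) (_ : NumberField K),
      Semistable W₀ ∧ GoodSS W₀ p ∧ W₀.frobeniusTrace p = 0 ∧ Module.finrank ℚ K = 2 ∧
      IsCoprime (NumberField.discr K) ((W₀.conductorNorm ℤ * p : ℕ) : ℤ) ∧
      (∀ (ℓ : ℕ) [Fact ℓ.Prime], (ℓ : ℤ) ∣ NumberField.discr K → GoodOrd W₀ ℓ) ∧
      (∃ C : VariableChange ℚ, C • W₀.quadraticTwist (NumberField.discr K : ℚ) = W) := by
  obtain ⟨W₀, _, _, d, C, hsst, hss, hap, hd, hd1, hram, hC⟩ := htw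
  have hpP : p.Prime := Fact.out
  -- every prime of `D ∈ {d, 4d}` is ramified, hence `≠ p`, good ordinary for `W₀` and prime to `N₀·p`
  have key : ∀ (D : ℤ), (∀ (ℓ : ℕ), ℓ.Prime → (ℓ : ℤ) ∣ D → RamifiedInQuadratic d ℓ) →
      IsCoprime D ((W₀.conductorNorm ℤ * p : ℕ) : ℤ) ∧
      (∀ (ℓ : ℕ) [Fact ℓ.Prime], (ℓ : ℤ) ∣ D → GoodOrd W₀ ℓ) := by
    intro D hD
    refine ⟨?_, fun ℓ hℓ hdvd ↦ (hram ℓ (hD ℓ hℓ.out hdvd)).2⟩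
    rw [Int.isCoprime_iff_gcd_eq_one]
    -- `Int.gcd D n = Nat.gcd |D| |n|`
    change Nat.Coprime D.natAbs (((W₀.conductorNorm ℤ * p : ℕ) : ℤ).natAbs)
    rw [Int.natAbs_natCast]
    by_contra hnc
    obtain ⟨ℓ, hℓ, hℓD, hℓN⟩ := Nat.Prime.not_coprime_iff_dvd.mp hnc
    haveI : Fact ℓ.Prime := ⟨hℓ⟩
    have hℓD' : (ℓ : ℤ) ∣ D := Int.natCast_dvd.mpr hℓD
    obtain ⟨hℓp, hgood, -⟩ := hram ℓ (hD ℓ hℓ hℓD')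
    rcases (Nat.Prime.dvd_mul hℓ).mp hℓN with hN | hP
    · exact (W₀.dvd_conductorNorm_iff_not_hasGoodReductionAtPrime ℓ).mp hN hgood
    · exact hℓp ((Nat.prime_dvd_prime_iff_eq hℓ hpP).mp hP)
  by_cases hd4 : d % 4 = 1
  · -- `d_K = d`
    obtain ⟨K, _iF, _iN, h2, hdisc⟩ := Quadratic.exists_numberField_discr_eq (D := d) (Or.inl ⟨hd4, hd, hd1⟩)
    obtain ⟨hcop, hord⟩ := key d (fun ℓ _ h ↦ Or.inl h)
    refine ⟨W₀, ‹_›, ‹_›, K, _iF, _iN, hsst, hss, hap, h2, ?_, ?_, ⟨C⁻¹, ?_⟩⟩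
    · rw [hdisc]; exact hcop
    · intro ℓ _ h; rw [hdisc] at h; exact hord ℓ h
    · rw [hdisc, ← hC, inv_smul_smul]
  · -- `d_K = 4d`
    have hd0 : d ≠ 0 := hd.ne_zero
    have hdmod : d % 4 = 2 ∨ d % 4 = 3 := by
      have h4 : ¬ (4 : ℤ) ∣ d := by
        intro h
        have h22 : (2 : ℤ) * 2 ∣ d := by simpa using h
        have hu := hd 2 h22
        rcases Int.isUnit_iff.mp hu with h1 | h1 <;> norm_num at h1
      omega
    obtain ⟨K, _iF, _iN, h2, hdisc⟩ := Quadratic.exists_numberField_discr_eq (D := 4 * d)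
      (Or.inr ⟨dvd_mul_right 4 d, by rw [Int.mul_ediv_cancel_left _ (by norm_num : (4 : ℤ) ≠ 0)]; exact hdmod,
        by rw [Int.mul_ediv_cancel_left _ (by norm_num : (4 : ℤ) ≠ 0)]; exact hd⟩)
    obtain ⟨hcop, hord⟩ := key (4 * d) (fun ℓ hℓ h ↦ ramifiedInQuadratic_of_dvd_four_mul hd4 hℓ h)
    obtain ⟨C', hC'⟩ := W₀.exists_variableChange_quadraticTwist_mul_sq (d : ℚ) 2 (by norm_num)
    refine ⟨W₀, ‹_›, ‹_›, K, _iF, _iN, hsst, hss, hap, h2, ?_, ?_, ⟨C⁻¹ * C'⁻¹, ?_⟩⟩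
    · rw [hdisc]; exact hcop
    · intro ℓ _ h; rw [hdisc] at h; exact hord ℓ h
    · have h4d : ((4 * d : ℤ) : ℚ) = (d : ℚ) * 2 ^ 2 := by push_cast; ring
      rw [hdisc, h4d, ← hC', mul_smul, inv_smul_smul, ← hC, inv_smul_smul]

/-- **Kobayashi's signed main conjecture AT THE TWIST, CONDITIONAL on BSTW Thm. 1.3's twist clause (B4, INTRO wording)** from an INTRO twist
datum: every sign. Binder: the PRE hypothesis `BurungaleSkinnerTianWan2024_thm13_twist_OPEN` (UNREFEREED preprint; its printed proof road is
GAP(line) per the litref D-audit; never a theorem). Closes nothing. [claim: BurungaleSkinnerTianWan2024, status: under-review]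
[cite: BurungaleSkinnerTianWan2024, Thm. 1.3 with twist clause (p. 3; ANNOUNCED, OPEN binder)] [cite: Kobayashi2003, Conjecture (Main Conjecture) (p. 2) (shape only)] -/
theorem kobayashiMainConjecture_of_thm13_twist_OPEN_of_twistIntro (hBSTW : BurungaleSkinnerTianWan2024_thm13_twist_OPEN) (hp2 : p ≠ 2)
    (htw : ∃ (W₀ : WeierstrassCurve ℚ) (_ : W₀.IsElliptic) (_ : W₀.IsGloballyMinimal) (d : ℤ) (C : VariableChange ℚ),
      Semistable W₀ ∧ GoodSS W₀ p ∧ W₀.frobeniusTrace p = 0 ∧ Squarefree d ∧ d ≠ 1 ∧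
      (∀ (q : ℕ) [Fact q.Prime], RamifiedInQuadratic d q → q ≠ p ∧ GoodOrd W₀ q) ∧
      C • W = W₀.quadraticTwist (d : ℚ)) (ε : ℤˣ) :
    KobayashiMainConjecture W p ε := by
  obtain ⟨W₀, _, _, K, _iF, _iN, hsst, hss, hap, h2, hcop, hord, hWd⟩ := exists_numberField_of_twistIntro W p htw
  have h4 : p = 3 → W₀.frobeniusTrace 3 = 0 := by intro h3; subst h3; exact hap
  exact hBSTW W₀ p hp2 hsst hss h4 K h2 hcop hord W hWd ε

/-- **The CRUX'S CONCLUSION `∃ ε, KobayashiLowerDivisibility W p ε` AT THE TWIST** (item stmt-BirchSwinnertonDyer-19001's statement at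
the pair), CONDITIONAL on B4, from an INTRO twist datum (witness `ε = 1`; `kobayashiLowerDivisibility_of_mainConjecture`). The crux itself
is untouched. [claim: BurungaleSkinnerTianWan2024, status: under-review] [cite: Kobayashi2003, Thm. 1.2, Thm. 4.1 and Conjecture (p. 2) (shape only)] -/
theorem exists_kobayashiLowerDivisibility_of_thm13_twist_OPEN_of_twistIntro
    (hBSTW : BurungaleSkinnerTianWan2024_thm13_twist_OPEN) (hp2 : p ≠ 2)
    (htw : ∃ (W₀ : WeierstrassCurve ℚ) (_ : W₀.IsElliptic) (_ : W₀.IsGloballyMinimal) (d : ℤ) (C : VariableChange ℚ),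
      Semistable W₀ ∧ GoodSS W₀ p ∧ W₀.frobeniusTrace p = 0 ∧ Squarefree d ∧ d ≠ 1 ∧
      (∀ (q : ℕ) [Fact q.Prime], RamifiedInQuadratic d q → q ≠ p ∧ GoodOrd W₀ q) ∧
      C • W = W₀.quadraticTwist (d : ℚ)) :
    ∃ ε : ℤˣ, KobayashiLowerDivisibility W p ε :=
  ⟨1, kobayashiLowerDivisibility_of_mainConjecture
    (kobayashiMainConjecture_of_thm13_twist_OPEN_of_twistIntro W p hBSTW hp2 htw 1)⟩

end Summit.BirchSwinnertonDyer.BirchSwinnertonDyer.Theorems.X7Twist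

end
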